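import Literature.MathematicalPhysics.QuantumFieldTheory.Balaban1983to89.Beta.RateCertificate
import Literature.MathematicalPhysics.QuantumFieldTheory.Balaban1983to89.Beta.Certified
import Literature.MathematicalPhysics.QuantumFieldTheory.Balaban1983to89.Beta.Drift
import Literature.MathematicalPhysics.QuantumFieldTheory.Balaban1983to89.Beta.LargeL
import Literature.MathematicalPhysics.QuantumFieldTheory.Balaban1983to89.Node00.Record13SepCoPH
import Summits.QuantumFields.YangMills.Theses.BalabanUVNodes
import Summits.QuantumFields.BalabanUV.Gaps.WeakestBetaCurrency
import Summits.QuantumFields.BalabanUV.Gaps.D1Residue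
import Summits.QuantumFields.YangMills.Theorems.BalabanUVNodesK2NamedJetsRemAt

/-!
# Sketch — crux idea `nesting-inheritance` for stmt-QuantumFields-20543 (EndpointGivenBR13SepCoPH)

First-lemma sketches (sequence algebra only; nothing of Bałaban's is asserted):
* `CumDefectBdd n b B C`  — the CUMULATIVE nesting defect between `n` steps of block `L` (one-loop coefficients `b`)
  and one step of block `L^n` (coefficients `B`) is bounded in `k`;
* `WindowDrift d A β0`    — one-sided windowed drift = socket (Q1) of `Gaps.WeakestBetaCurrency.Quarters`;
* `TransferUp` (proved), `TransferDown` (stated = FIRST LEMMA of the line): (Q1) is a nesting-class invariant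
  modulo `CumDefectBdd` (slope `d ↦ n·d` upward, `d ↦ d/n` downward);
* `abelian_nesting_exact` (proved): for U(1) the nesting defect is IDENTICALLY ZERO
  (`blockSum n (abelianCoeff L) = abelianCoeff (L^n)`), the rung / cheapest in-Lean falsifier passed.
HONEST: Clay YM mass gap NOT proved; R4 closes only the conditional finite-𝕋⁴ rung `BalabanLadder.UV`;
[Balaban1987RG1] Thm 2 / (0.31) p. 259 unproved in print.

## EDITION 2 (seat idea-8 gen 3, 2026-08-28) — answers to CRIT-2 ROUND 2b's prices P1⁸–P4⁸ (`CRIT-2-ROUND2b.md`), §§4–8 below; §§1–3 = edition 1 verbatim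
* §4 (P3⁸, ONE-SIDED SUFFICIENCY, proved): the END reads the one-sided windowed drift (Q1) `WindowDrift d A b`, a constant remainder
  `ConstRemainder β (c • b) s γ₀` (DEF-1's letter conjunct, BY NAME) with the seam `s ≤ c·d`, a crude CEILING `b ≤ M` and (C) — nothing two-sided:
  `endpointExistence_of_windowDrift_constRemainder_cont` via `FlowStepRuns.endpointExistence_of_partialSums` BY NAME (`M := c·A`, `β′ := max 0 (c·M + s)`).
* §5 `ShortSlopeDrift s₀ b := ∀ η > 0, ∃ A, WindowDrift (s₀ − η) A b` (what nesting delivers: slope `b·log L − A/m` for every `m`), WEAKER than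
  `OneLoopDrift s₀ A b` (`shortSlopeDrift_of_oneLoopDrift`); the END at every short slope needs the STRICT seam `s < c·s₀`
  (`endpointExistence_of_shortSlopeDrift_constRemainder_cont`); ★ `shortSlopeDrift_of_nesting` ∕ `shortSlopeDrift_stepBal_of_nesting`: (AF-0-L) on the CLASS TAIL
  `{Lc^m : m ≥ m₀}` with ONE pair `(b, A)` + `CumDefectBdd m` for every `m ≥ m₀` + a crude bound at base `Lc` ⟹ `ShortSlopeDrift (b·log Lc) (β0 Lc)`
  (`b·log L = stepBal 2 L` for `b = 11·2²/12π²`, `B12Normalization.stepBal_eq`).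
* §6 (P2⁸, RE-KEYED θ-COVARIANTLY ON THE NAMED NUMBERS, κ AFTER θ; the letter of record READ, never edited): the line's (D1)-side text
  `Q1AtShadowingJets13 := ∀ F κ θ hP, Admissible → RemAt F κ θ hP θ.cβ → ShortSlopeDrift (stepBal 2 F.L) (beta0OfJs F κ) ∧ ∃ M, ∀ k, beta0OfJs F κ k ≤ M`
  (IMPLIED BY v4's stub 1′ text `D1AtShadowingJets`, `q1AtShadowingJets13_of_d1AtShadowingJets`); the (D4)-side text WITH SLACK `RemAtLTSomeJets13 := ∀ F θ hP, Admissible →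
  ∃ κ, RemAtLT F κ θ hP θ.cβ`, `RemAtLT` = DEF-1's `RemAt` with the cap STRICT `s < c·stepBal 2 F.L` (`remAt_of_remAtLT`; CRIT-1's linear letter `RemAtN` ⟹ `RemAtLT`,
  `remAtLT_of_remAtN` — linear letters carry the slack for free; every-constant letters too, `remAtLT_of_remAt_everyConst`); ★★ `EndpointGivenBR13SepCoPH_of_nestingJets :
  Q1AtShadowingJets13 → RemAtLTSomeJets13 → ‹the crux decl BY NAME›`.  Honours p592392 (κ after θ, `θ.cβ` carried), p592695 ∕ p592909 (no per-tuple anchor at own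
  zero-history values: the anchor is DEF-1's `ScaleAnchor` at the NAMED numbers).  Edition 1's `Q1AtRecord13` (§3, v₀-ray identification) is kept for lineage and FLAGGED EXPOSED.
* §7 (P1⁸ stated plainly, kernel): with value laws `b_j = σ + τ_j` at `L` and `B_j = Σ + T_j` at `L^m` and summable transients at BOTH blocks, `CumDefectBdd m b B C` holds
  iff the stationary values NEST EXACTLY, `Σ = m·σ` (`cumDefectBdd_of_stationary_transients`, `stationary_nesting_of_cumDefectBdd`) — i.e. in the convergent regime S-NEST is
  road «FP»'s additivity `β∞(L^m) = m·β∞(L)` restricted to powers PLUS transient death at both blocks; independent content only via a direct coboundary ∕ Schur route (F3).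
* §8 KNIFE-EDGE WITNESS (why the slack is needed, kernel): `bKnife j = 1 − 1/(j+1)`, `betaKnife j _ = −1/(j+1)`: `ShortSlopeDrift 1 bKnife`, `ConstRemainder betaKnife (1 • bKnife) 1 γ`
  (cap `s = c·s₀` met with EQUALITY), ceiling, (C) all hold, yet `¬ BetaPartialSumsLowerH M γ betaKnife` for every `M` (harmonic divergence,
  `Real.tendsto_sum_range_one_div_nat_succ_atTop`) — the END's necessary currency fails: a sub-AF-slope (D1)-supplier cannot close through the non-strict cap.
## EDITION 3 (seat idea-8 gen 4, 2026-08-28) — P1⁸ ∕ F3 MADE CONCRETE (CRIT-2 ROUND 2d: «the one independent bet = a direct boundedness proof»), §9 below; §§1–8 verbatim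
* §9 **BST** (bounded semigroup transfer) `BSTSeq b L μ₁ T := ∀ k ≥ 1, |Σ_{j<k} b j − μ₁ (L^k)| ≤ T` with `μ₁` THE GENUINE FIRST-STEP family (`BST β L T`, `μ₁ n := β n 0`):
  `OneShotTelescope`'s exact (T1) `hTel` (dead by data, `e(k=0) = 0.210 ± 0.018`) in BOUNDED form.  Kernel: `bst_abelian` (U(1): `T = 0`), `cumDefectBdd_of_bst`
  (BST at bases `L`, `L^m` ⟹ S-NEST with `T₁ + T₂` — P1⁸ follows from BST), `oneLoopDrift_of_bst_logGrowth` ∕ `oneLoopDrift_stepBal_of_bstSeq` (BST + the two-sided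
  FIRST-STEP law (T2) ⟹ two-sided drift at slope `stepBal`, defect `A + T`), ★ `EndpointGivenBR13SepCoPH_of_bst_remAtLT` (⟹ the crux BY NAME via §6), honesty lemma
  `bstSeq_of_oneLoopDrift` (with `μ₁` free BST is drift re-keyed: the content is the IDENTITY of `μ₁`).  §9b: the COARSE-LEG bookkeeping of the intended proof of BST in a
  finite-dimensional KKT model (`shear_conj_of_mul_eq_zero`, `kernel_transport`, `kkt_trace_d2_split`, `kkt_trace_sq_split`: in `Π = −½[tr K₀⁻¹∂²K − tr (K₀⁻¹∂K)²]` the only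
  coarse-leg-free terms are `tr(𝒢∂²Δ)` and `tr((𝒢∂Δ)²)`).  The coarse-leg ESTIMATE itself (uniform composite propagator bounds in coarse units + Ward-reorganised contacts)
  is NOT done here and is the card's named proof task.
Nothing of Bałaban's analysis is asserted anywhere: every drift ∕ remainder ∕ anchor ∕ nesting ∕ transfer bound is a HYPOTHESIS SHAPE; K2⁷ NOT closed; counts unmoved.
-/

namespace Summit.QuantumFields.YangMills.Cruxes.EndpointGivenBR13SepCoPH.NestingInheritance

open Literature.MathematicalPhysics.QuantumFieldTheory.Balaban1983to89.Beta.RateCertificate (blockSum)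
open Literature.MathematicalPhysics.QuantumFieldTheory.Balaban1983to89.Beta.Certified (abelianCoeff sum_range_abelianCoeff)

/-- Cumulative nesting defect bounded in `k`: `|Σ_{j<nk} b j − Σ_{j<k} B j| ≤ C`. -/
def CumDefectBdd (n : ℕ) (b B : ℕ → ℝ) (C : ℝ) : Prop :=
  ∀ k : ℕ, |∑ j ∈ Finset.range (n * k), b j - ∑ j ∈ Finset.range k, B j| ≤ C

/-- One-sided windowed drift with slope `d` and defect `A` (shape of (Q1) in `WeakestBetaCurrency.Quarters`). -/
def WindowDrift (d A : ℝ) (β0 : ℕ → ℝ) : Prop :=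
  ∀ k n : ℕ, k ≤ n → d * ((n : ℝ) - k) - A ≤ ∑ j ∈ Finset.Ico k n, β0 j

/-- UPWARD transfer (small block → large block): windows of the `L^n`-chain are windows of the `L`-chain at
multiples of `n`, up to `2C`. -/
def TransferUp : Prop :=
  ∀ (n : ℕ) (b B : ℕ → ℝ) (C d A : ℝ), 0 < n → CumDefectBdd n b B C → WindowDrift d A b →
    WindowDrift (n * d) (A + 2 * C) B

/-- FIRST LEMMA — DOWNWARD transfer (large block → small block): a window `[k, m)` of the `L`-chain contains the
aligned window `[n⌈k/n⌉, n⌊m/n⌋)`, which is a window of the `L^n`-chain up to `2C`; the two ragged ends cost at most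
`2n·M` where `M` bounds `|b|`. -/
def TransferDown : Prop :=
  ∀ (n : ℕ) (b B : ℕ → ℝ) (C d A M : ℝ), 0 < n → CumDefectBdd n b B C → WindowDrift d A B →
    (∀ j, |b j| ≤ M) → 0 ≤ d → WindowDrift (d / n) (A + 2 * C + 2 * n * M + 2 * d) b

theorem transferUp_holds : TransferUp := by
  intro n b B C d A _hn hcum hwin k m hkm
  have h1 := hcum k
  have h2 := hcum m
  have hnk : n * k ≤ n * m := Nat.mul_le_mul_left n hkm
  have hw := hwin (n * k) (n * m) hnk
  rw [Finset.sum_Ico_eq_sub _ hkm]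
  rw [Finset.sum_Ico_eq_sub _ hnk] at hw
  rw [abs_le] at h1 h2
  push_cast at hw
  have e : (n : ℝ) * d * ((m : ℝ) - k) = d * ((n : ℝ) * m - (n : ℝ) * k) := by ring
  linarith [h1.1, h1.2, h2.1, h2.2]

/-- The downward transfer, PROVED (sequence algebra: aligned middle window + two ragged ends). -/
theorem transferDown_holds : TransferDown := by
  intro n b B C d A M hn hcum hwin hbd hd k m hkm
  have hn' : (0 : ℝ) < n := by exact_mod_cast hn
  have hA : 0 ≤ A := by
    have h := hwin 0 0 le_rfl
    simp at h
    linarith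
  have hC : 0 ≤ C := by
    have h := hcum 0
    simpa using h
  have hM : 0 ≤ M := (abs_nonneg _).trans (hbd 0)
  -- short sums are ≥ −M·(length)
  have hshort : ∀ a c : ℕ, a ≤ c → -(M * ((c : ℝ) - a)) ≤ ∑ j ∈ Finset.Ico a c, b j := by
    intro a c hac
    have h := Finset.sum_le_sum (s := Finset.Ico a c) (fun j _ => (abs_le.mp (hbd j)).1)
    simp only [Finset.sum_const, Nat.card_Ico] at h
    have : ∑ _j ∈ Finset.Ico a c, (-M) = ((c - a : ℕ) : ℝ) * (-M) := by
      simp [Finset.sum_const, Nat.card_Ico]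
    have h' : ((c - a : ℕ) : ℝ) * (-M) ≤ ∑ j ∈ Finset.Ico a c, b j := by
      rw [← this]; exact Finset.sum_le_sum (fun j _ => (abs_le.mp (hbd j)).1)
    rw [Nat.cast_sub hac] at h'
    linarith
  -- aligned windows of the L-chain are windows of the L^n-chain up to 2C
  have hwin' : ∀ k' m' : ℕ, k' ≤ m' →
      d * ((m' : ℝ) - k') - A - 2 * C ≤ ∑ j ∈ Finset.Ico (n * k') (n * m'), b j := by
    intro k' m' hkm'
    have h1 := hcum k'
    have h2 := hcum m'
    have hw := hwin k' m' hkm'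
    rw [Finset.sum_Ico_eq_sub _ hkm'] at hw
    rw [Finset.sum_Ico_eq_sub _ (Nat.mul_le_mul_left n hkm')]
    rw [abs_le] at h1 h2
    linarith [h1.1, h1.2, h2.1, h2.2]
  -- integer bookkeeping: k' := k/n + 1, m' := m/n
  have hk1 : k ≤ n * (k / n + 1) :=
    calc k ≤ k / n * n + n := (Nat.lt_div_mul_add hn).le
      _ = n * (k / n + 1) := by ring
  have hk2 : n * (k / n + 1) ≤ k + n :=
    calc n * (k / n + 1) = k / n * n + n := by ring
      _ ≤ k + n := Nat.add_le_add_right (Nat.div_mul_le_self k n) n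
  have hm1 : n * (m / n) ≤ m := by rw [mul_comm]; exact Nat.div_mul_le_self m n
  have hm2 : m < n * (m / n) + n := by
    calc m < m / n * n + n := Nat.lt_div_mul_add hn
      _ = n * (m / n) + n := by ring
  have r1 : (k : ℝ) ≤ (n : ℝ) * ((k / n + 1 : ℕ) : ℝ) := by exact_mod_cast hk1
  have r2 : (n : ℝ) * ((k / n + 1 : ℕ) : ℝ) ≤ k + n := by exact_mod_cast hk2
  have r3 : (n : ℝ) * ((m / n : ℕ) : ℝ) ≤ m := by exact_mod_cast hm1
  have r4 : (m : ℝ) < (n : ℝ) * ((m / n : ℕ) : ℝ) + n := by exact_mod_cast hm2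
  have hdn : 0 ≤ d / n := div_nonneg hd hn'.le
  by_cases hcase : k / n + 1 ≤ m / n
  · -- Case A: the aligned middle window is non-empty
    have hmid : n * (k / n + 1) ≤ n * (m / n) := Nat.mul_le_mul_left n hcase
    have s1 := Finset.sum_Ico_consecutive b hk1 (hmid.trans hm1)
    have s2 := Finset.sum_Ico_consecutive b hmid hm1
    have e1 := hshort k (n * (k / n + 1)) hk1
    have e2 := hshort (n * (m / n)) m hm1
    have mid := hwin' (k / n + 1) (m / n) hcase
    have key : d / n * ((m : ℝ) - k) - 2 * d ≤ d * (((m / n : ℕ) : ℝ) - ((k / n + 1 : ℕ) : ℝ)) := by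
      have e : d * (((m / n : ℕ) : ℝ) - ((k / n + 1 : ℕ) : ℝ))
          = d / n * ((n : ℝ) * ((m / n : ℕ) : ℝ) - (n : ℝ) * ((k / n + 1 : ℕ) : ℝ)) := by
        field_simp
      rw [e]
      have e' : d / n * ((m : ℝ) - k) - 2 * d = d / n * (((m : ℝ) - n) - (k + n)) := by
        field_simp
        ring
      rw [e']
      exact mul_le_mul_of_nonneg_left (by linarith) hdn
    have f1 : -(M * n) ≤ ∑ j ∈ Finset.Ico k (n * (k / n + 1)), b j := by
      have : M * (((n * (k / n + 1) : ℕ) : ℝ) - k) ≤ M * n := by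
        apply mul_le_mul_of_nonneg_left _ hM
        push_cast
        push_cast at r2
        linarith
      linarith [e1]
    have f2 : -(M * n) ≤ ∑ j ∈ Finset.Ico (n * (m / n)) m, b j := by
      have : M * ((m : ℝ) - ((n * (m / n) : ℕ) : ℝ)) ≤ M * n := by
        apply mul_le_mul_of_nonneg_left _ hM
        push_cast
        linarith
      linarith [e2]
    rw [← s1, ← s2]
    linarith [mid, key, f1, f2]
  · -- Case B: the window is shorter than one block
    have hlt : m / n < k / n + 1 := Nat.lt_of_not_le hcase
    have hle : m / n ≤ k / n := Nat.lt_succ_iff.mp hlt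
    have hmk : m < k + n :=
      calc m < m / n * n + n := Nat.lt_div_mul_add hn
        _ ≤ k / n * n + n := by gcongr
        _ ≤ k + n := Nat.add_le_add_right (Nat.div_mul_le_self k n) n
    have e := hshort k m hkm
    have r : (m : ℝ) < k + n := by exact_mod_cast hmk
    have t : d / n * ((m : ℝ) - k) ≤ d / n * n := mul_le_mul_of_nonneg_left (by linarith) hdn
    have t' : d / n * (n : ℝ) = d := by field_simp
    have u : M * ((m : ℝ) - k) ≤ M * n := mul_le_mul_of_nonneg_left (by linarith) hM
    have v : 0 ≤ M * (n : ℝ) := mul_nonneg hM hn'.le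
    have hkm' : (k : ℝ) ≤ m := by exact_mod_cast hkm
    have v' : 0 ≤ M * ((m : ℝ) - k) := mul_nonneg hM (by linarith)
    linarith [e, t, t', u, v, v']

/-- ABELIAN RUNG: for U(1) the nesting is EXACT — `n` steps of block `L` sum to one step of block `L^n`
(`abelianCoeff L k = (L⁴−1)/(4L^{4(k+1)})`, `Beta.Certified`). -/
theorem abelian_nesting_exact {L : ℕ} (hL : L ≠ 0) (n k : ℕ) :
    ∑ i ∈ Finset.range n, abelianCoeff L (n * k + i) = abelianCoeff (L ^ n) k := by
  have hL' : (L : ℚ) ≠ 0 := by exact_mod_cast hL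
  have h := Finset.sum_range_add_sub_sum_range (abelianCoeff L) (n * k) n
  rw [← h, sum_range_abelianCoeff hL, sum_range_abelianCoeff hL]
  unfold abelianCoeff
  push_cast
  simp only [← pow_mul]
  rw [show 4 * (n * k + n) = 4 * (n * k) + 4 * n by ring, show n * 4 = 4 * n by ring,
    show n * (4 * (k + 1)) = 4 * (n * k) + 4 * n by ring, pow_add]
  have ha : (L : ℚ) ^ (4 * (n * k)) ≠ 0 := pow_ne_zero _ hL'
  have hc : (L : ℚ) ^ (4 * n) ≠ 0 := pow_ne_zero _ hL'
  field_simp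
  ring

/-- The same in the tree's `blockSum` currency (real-valued). -/
theorem abelian_hblock {L : ℕ} (hL : L ≠ 0) (n k : ℕ) :
    blockSum n (fun j => (abelianCoeff L j : ℝ)) k = (abelianCoeff (L ^ n) k : ℝ) := by
  have h := abelian_nesting_exact hL n k
  unfold blockSum
  show ∑ i ∈ Finset.range n, ((abelianCoeff L (n * k + i) : ℚ) : ℝ) = ((abelianCoeff (L ^ n) k : ℚ) : ℝ)
  exact_mod_cast h

/-- Hence the abelian cumulative nesting defect is zero: `CumDefectBdd n (abelianCoeff L) (abelianCoeff (L^n)) 0`. -/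
theorem abelian_cumDefect_zero {L : ℕ} (hL : L ≠ 0) (n : ℕ) :
    CumDefectBdd n (fun j => (abelianCoeff L j : ℝ)) (fun j => (abelianCoeff (L ^ n) j : ℝ)) 0 := by
  intro k
  induction k with
  | zero => simp
  | succ k ih =>
    have hsplit : ∑ j ∈ Finset.range (n * (k + 1)), (abelianCoeff L j : ℝ)
        = ∑ j ∈ Finset.range (n * k), (abelianCoeff L j : ℝ) + blockSum n (fun j => (abelianCoeff L j : ℝ)) k := by
      rw [show n * (k + 1) = n * k + n by ring, Finset.sum_range_add]
      rfl
    rw [hsplit, abelian_hblock hL, Finset.sum_range_succ]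
    have : |∑ j ∈ Finset.range (n * k), (abelianCoeff L j : ℝ) - ∑ j ∈ Finset.range k, (abelianCoeff (L ^ n) j : ℝ)| ≤ 0 := ih
    have h0 := abs_nonpos_iff.mp this
    rw [abs_nonpos_iff]
    linarith

/-! ## §2 The nesting supplier of (Q1) at a small block from (AF-0-L) at ONE large block of the same class -/

open Literature.MathematicalPhysics.QuantumFieldTheory.Balaban1983to89.Beta.LargeL (LogGrowthLowerOn)

/-- A pointwise floor is a windowed drift with zero defect. [folklore] -/
theorem windowDrift_of_floor {D : ℝ} {B : ℕ → ℝ} (h : ∀ k, D ≤ B k) : WindowDrift D 0 B := by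
  intro k n hkn
  have h1 := Finset.sum_le_sum (s := Finset.Ico k n) (fun j _ => h j)
  simp only [Finset.sum_const, Nat.card_Ico] at h1
  rw [nsmul_eq_mul, Nat.cast_sub hkn] at h1
  linarith

/-- **NESTING INHERITANCE** (the line's junction, PROVED): for a volume-free family `β0 L k = β⁰_{k+1}(L)` of one-loop
coefficients indexed by the blocking factor, (AF-0-L) asked ONLY at the one class member `Lc^m` (`LogGrowthLowerOn (· = Lc^m)`,
any constant `A`, provided the floor `b·log(Lc^m) − A` is non-negative), the bounded cumulative nesting defect between base `Lc`
and base `Lc^m`, and a crude two-sided bound at base `Lc` give the one-sided windowed drift (Q1) AT BASE `Lc` with slope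
`(b·log(Lc^m) − A)/m = b·log Lc − A/m` — the constant `A` is divided by the nesting exponent. -/
theorem q1_of_nesting {β0 : ℕ → ℕ → ℝ} {Lc m : ℕ} (hLc : 2 ≤ Lc) (hm : 0 < m) {b A C M : ℝ}
    (hAF : LogGrowthLowerOn (fun L => L = Lc ^ m) β0 b A) (hfloor : 0 ≤ b * Real.log ((Lc ^ m : ℕ) : ℝ) - A)
    (hcum : CumDefectBdd m (β0 Lc) (β0 (Lc ^ m)) C) (hbd : ∀ j, |β0 Lc j| ≤ M) :
    WindowDrift ((b * Real.log ((Lc ^ m : ℕ) : ℝ) - A) / m)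
      (0 + 2 * C + 2 * m * M + 2 * (b * Real.log ((Lc ^ m : ℕ) : ℝ) - A)) (β0 Lc) := by
  have h2 : 2 ≤ Lc ^ m := by
    calc 2 ≤ Lc := hLc
      _ = Lc ^ 1 := (pow_one Lc).symm
      _ ≤ Lc ^ m := Nat.pow_le_pow_right (by omega) hm
  have hpt : ∀ k, b * Real.log ((Lc ^ m : ℕ) : ℝ) - A ≤ β0 (Lc ^ m) k := fun k => hAF (Lc ^ m) rfl h2 k
  exact transferDown_holds m (β0 Lc) (β0 (Lc ^ m)) C _ 0 M hm hcum (windowDrift_of_floor hpt) hbd hfloor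

/-- The slope bookkeeping: `(b·log(Lc^m) − A)/m = b·log Lc − A/m`. [folklore] -/
theorem slope_of_nesting {Lc m : ℕ} (hm : 0 < m) (b A : ℝ) :
    (b * Real.log ((Lc ^ m : ℕ) : ℝ) - A) / m = b * Real.log (Lc : ℝ) - A / m := by
  have hm' : (m : ℝ) ≠ 0 := by exact_mod_cast hm.ne'
  push_cast
  rw [Real.log_pow]
  field_simp

/-! ## §3 The (Q1) shape AT THE RECORD (K2⁷'s universe) — what a line's (D1)-side stub would read -/

section Record

open Literature.MathematicalPhysics.QuantumFieldTheory.Balaban1983to89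
open Literature.MathematicalPhysics.QuantumFieldTheory.Balaban1983to89.T4Continuum (T4Family)
open Literature.MathematicalPhysics.QuantumFieldTheory.Balaban1983to89.Node00
open Literature.MathematicalPhysics.QuantumFieldTheory.Balaban1983to89.Beta.OneStepKernelFamily (TbalOf)
open Literature.MathematicalPhysics.QuantumFieldTheory.Balaban1983to89.Beta.OneStepResolventKernel (JetData)
open scoped Matrix.Norms.L2Operator

/-- (EDITION 1, kept for lineage; FLAGGED EXPOSED by CRIT-2 2b P2⁸ — the v₀-ray identification clause is line 2's retired keying, cf. p592695;
superseded by §6's `Q1AtShadowingJets13` keyed on the NAMED numbers `θ.cβ • beta0OfJs F κ`.)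
**(Q1) AT THE RECORD** — the ONE-SIDED (D1)-side hypothesis shape a nesting line would register in place of line 2's
`D1AtRecord13Pos` (K2⁷ skeleton v3): the record's one-loop coefficients are the volume-free `secondMoment ∘ TbalOf Lc Js` (line 2's
identification clause, verbatim) AND obey a one-sided windowed drift with positive slope.  NO value law, NO `D1Residue.Residue`,
NO `OneShotLaw`.  A hypothesis SHAPE, never a fact; nothing of Bałaban's is asserted. -/
def Q1AtRecord13 : Prop :=
  ∀ (F : T4Family) (θ : Node00.Stage13HParams F 2) (_hP : θ.Provisos₁₃SepCoPH F 2), θ.Admissible F 2 →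
    letI := θ.instVβ₁; letI := θ.instVβ₂; letI := θ.instιβ
    ∃ (Lc : ℕ) (_ : NeZero Lc) (Js : ℕ → JetData 3 Lc) (d A : ℝ), 0 < d ∧
      (∀ j, beta0OfMerged (betaMerged F (mergedTermFamilyMatT F 2 (TcanOfRecord F 2) (chiFixed29 F 2 θ.ν θ.ε₂₉) θ.εbg)
          θ.ρ8 θ.bV) θ.v₀ j = B12Beta.secondMoment (TbalOf Lc Js j) 0 1) ∧
      WindowDrift d A (fun j => B12Beta.secondMoment (TbalOf Lc Js j) 0 1)

end Record

/-! ## §4 (edition 2, P3⁸) ONE-SIDED SUFFICIENCY — the END reads (Q1) + a constant remainder + a ceiling + (C); nothing two-sided -/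

section OneSided

open Literature.MathematicalPhysics.QuantumFieldTheory.Balaban1983to89
open Literature.MathematicalPhysics.QuantumFieldTheory.Balaban1983to89.FlowStep
open Literature.MathematicalPhysics.QuantumFieldTheory.Balaban1983to89.FlowStepRuns (BetaPartialSumsLowerH endpointExistence_of_partialSums histBox_of_mem_box)
open Literature.MathematicalPhysics.QuantumFieldTheory.Balaban1983to89.DagBinding (EndpointExistence ForwardGenerated)
open Literature.MathematicalPhysics.QuantumFieldTheory.Balaban1983to89.B12Beta (HistBox)
open Literature.MathematicalPhysics.QuantumFieldTheory.Balaban1983to89.Beta.Drift (OneLoopDrift sum_Ico_ge_of_drift)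
open Summit.QuantumFields.YangMills.Theorems.BalabanUVNodesK2NamedJetsRemAt (ConstRemainder)

variable {β : HBeta} {b : ℕ → ℝ}

/-- A windowed drift has a non-negative defect (empty window). [folklore] -/
theorem WindowDrift.nonneg {d A : ℝ} (h : WindowDrift d A b) : 0 ≤ A := by
  have h0 := h 0 0 le_rfl
  simp at h0
  linarith

/-- (Q1) is ANTITONE in the slope. [folklore] -/
theorem WindowDrift.of_le {d d' A : ℝ} (h : WindowDrift d A b) (hle : d' ≤ d) : WindowDrift d' A b := by
  intro k n hkn
  have h1 := h k n hkn
  have hkn' : (k : ℝ) ≤ n := by exact_mod_cast hkn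
  have h2 : d' * ((n : ℝ) - k) ≤ d * ((n : ℝ) - k) := mul_le_mul_of_nonneg_right hle (by linarith)
  linarith

/-- (Q1) is MONOTONE in the defect. [folklore] -/
theorem WindowDrift.of_defect_le {d A A' : ℝ} (h : WindowDrift d A b) (hle : A ≤ A') : WindowDrift d A' b :=
  fun k n hkn => by
    have h1 := h k n hkn
    linarith

/-- TWO-SIDED ⟹ ONE-SIDED: `OneLoopDrift s A b` ([II] (2.38)) gives `WindowDrift s (2A) b` (`Beta.Drift.sum_Ico_ge_of_drift` BY NAME).
[cite: Balaban1988RG2Cluster, Lemma 3 (2.38) p.20] -/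
theorem windowDrift_of_oneLoopDrift {s A : ℝ} (h : OneLoopDrift s A b) : WindowDrift s (2 * A) b :=
  fun _k _n hkn => sum_Ico_ge_of_drift h hkn

/-- **(A-ps) FROM (Q1) AND A ONE-SIDED CONSTANT REMAINDER AT SCALE `c ≥ 0` WITH THE SEAM `s ≤ c·d`**: partial sums of `β` along `]0, γ₀]`-histories
are `≥ −c·A`.  an4's `betaPartialSumsLowerH_of_drift_lowerRemainder` with the two-sided drift replaced by the one-sided window bound it actually uses.
[cite: Balaban1987RG1, Thm 2 p.259 (first sentence) and (5.10) p.293] -/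
theorem betaPartialSumsLowerH_of_windowDrift_lowerRemainder {d A s c γ₀ : ℝ} (hc : 0 ≤ c) (hwin : WindowDrift d A b)
    (hrem : ∀ (k : ℕ) (p : Fin (k + 1) → ℝ), p ∈ HistBox γ₀ k → c * b k - s ≤ β k p) (hseam : s ≤ c * d) :
    BetaPartialSumsLowerH (c * A) γ₀ β := by
  intro g hg k n hkn
  have hstep : ∀ j, c * b j - s ≤ β j (prefixOf g j) := fun j => hrem j _ fun i => hg i
  have hsum : ∑ j ∈ Finset.Ico k n, (c * b j - s) ≤ ∑ j ∈ Finset.Ico k n, β j (prefixOf g j) :=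
    Finset.sum_le_sum fun j _ => hstep j
  have hsplit : ∑ j ∈ Finset.Ico k n, (c * b j - s) = c * ∑ j ∈ Finset.Ico k n, b j - s * ((n : ℝ) - k) := by
    rw [Finset.sum_sub_distrib, Finset.sum_const, Nat.card_Ico, nsmul_eq_mul, Nat.cast_sub hkn, ← Finset.mul_sum]
    ring
  have hdr := hwin k n hkn
  have hkn' : (k : ℝ) ≤ n := by exact_mod_cast hkn
  have h1 : c * (d * ((n : ℝ) - k) - A) ≤ c * ∑ j ∈ Finset.Ico k n, b j := mul_le_mul_of_nonneg_left hdr hc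
  have e1 : c * (d * ((n : ℝ) - k) - A) = c * d * ((n : ℝ) - k) - c * A := by ring
  have h2 : s * ((n : ℝ) - k) ≤ c * d * ((n : ℝ) - k) := mul_le_mul_of_nonneg_right hseam (by linarith)
  linarith

/-- **THE CEILING FROM A CRUDE UPPER BOUND OF THE REFERENCE SEQUENCE AND A ONE-SIDED CONSTANT REMAINDER**: `b ≤ M`, `β_{k+1}(p) ≤ c·b_k + s` on the boxes, `0 ≤ c`
⟹ `BetaUpperH (c·M + s) γ₀ β`. [cite: Balaban1987RG1, (1.20)–(1.22) p.264] -/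
theorem betaUpperH_of_ceiling_upperRemainder {M s c γ₀ : ℝ} (hc : 0 ≤ c) (hbd : ∀ k, b k ≤ M)
    (hrem : ∀ (k : ℕ) (p : Fin (k + 1) → ℝ), p ∈ HistBox γ₀ k → β k p ≤ c * b k + s) :
    BetaUpperH (c * M + s) γ₀ β := by
  intro k v hv
  have h1 := hrem k v (histBox_of_mem_box hv)
  have h2 : c * b k ≤ c * M := mul_le_mul_of_nonneg_left (hbd k) hc
  linarith

/-- **★ ONE-SIDED END** (forward-generated constructions): (Q1) `WindowDrift d A b`, a crude ceiling `b ≤ M`, DEF-1's constant remainder `ConstRemainder β (c • b) s γ₀`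
(BY NAME) at a scale `c ≥ 0` with the seam `s ≤ c·d`, and (C) ⟹ `EndpointExistence C` — `FlowStepRuns.endpointExistence_of_partialSums` BY NAME with `M := c·A`,
`β′ := max 0 (c·M + s)`.  Nothing two-sided is read: THIS is the socket a nesting ∕ (Q1) supplier plugs into (CRIT-2 2b P3⁸).  A conditional; K2⁷ NOT closed.
[cite: Balaban1987RG1, Thm 2 p.259 (first sentence), (5.10) p.293 and (1.20)–(1.22) p.264] -/
theorem endpointExistence_of_windowDrift_constRemainder_cont {C : B12.Construction} (hgen : ForwardGenerated C β)
    {γ₀ d A M s c : ℝ} (hγ₀ : 0 < γ₀) (hc : 0 ≤ c) (hwin : WindowDrift d A b) (hbd : ∀ k, b k ≤ M)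
    (hrem : ConstRemainder β (fun k => c * b k) s γ₀) (hseam : s ≤ c * d) (hcont : BetaContH γ₀ β) :
    EndpointExistence C := by
  have hA : 0 ≤ A := hwin.nonneg
  have hlo : ∀ (k : ℕ) (p : Fin (k + 1) → ℝ), p ∈ HistBox γ₀ k → c * b k - s ≤ β k p := fun k p hp => by
    have h : |β k p - c * b k| ≤ s := hrem k p hp
    have h' := (abs_le.mp h).1
    linarith
  have hhi : ∀ (k : ℕ) (p : Fin (k + 1) → ℝ), p ∈ HistBox γ₀ k → β k p ≤ c * b k + s := fun k p hp => by
    have h : |β k p - c * b k| ≤ s := hrem k p hp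
    have h' := (abs_le.mp h).2
    linarith
  have hup : BetaUpperH (c * M + s) γ₀ β := betaUpperH_of_ceiling_upperRemainder hc hbd hhi
  have hup' : BetaUpperH (max 0 (c * M + s)) γ₀ β := fun k v hv => (hup k v hv).trans (le_max_right _ _)
  exact endpointExistence_of_partialSums hgen hγ₀ (mul_nonneg hc hA) (le_max_left _ _) hcont
    (betaPartialSumsLowerH_of_windowDrift_lowerRemainder hc hwin hlo hseam) hup'

/-! ## §5 (edition 2) THE EVERY-SHORT-SLOPE (Q1) — what nesting delivers — and its END with a STRICT seam -/

/-- HYPOTHESIS SHAPE: **(Q1) AT EVERY SLOPE SHORT OF `s₀`** — for every `η > 0` some defect `A_η` with `WindowDrift (s₀ − η) A_η b`.  What the nesting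
supplier delivers at base `L` (slope `b·log L − A/m`, every `m`); strictly WEAKER than a drift AT slope `s₀` (§8's knife-edge profile has it at `s₀ = 1`
and no `WindowDrift 1 A`).  A predicate, never a fact. [folklore] -/
def ShortSlopeDrift (s₀ : ℝ) (b : ℕ → ℝ) : Prop :=
  ∀ η : ℝ, 0 < η → ∃ A : ℝ, WindowDrift (s₀ - η) A b

/-- (Q1) at slope `s₀` ⟹ (Q1) at every shorter slope. [folklore] -/
theorem shortSlopeDrift_of_windowDrift {s₀ A : ℝ} (h : WindowDrift s₀ A b) : ShortSlopeDrift s₀ b :=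
  fun _η hη => ⟨A, h.of_le (by linarith)⟩

/-- Two-sided drift at slope `s₀` ([II] (2.38), stub 1′'s conclusion) ⟹ (Q1) at every shorter slope. [cite: Balaban1988RG2Cluster, Lemma 3 (2.38) p.20] -/
theorem shortSlopeDrift_of_oneLoopDrift {s₀ A : ℝ} (h : OneLoopDrift s₀ A b) : ShortSlopeDrift s₀ b :=
  shortSlopeDrift_of_windowDrift (windowDrift_of_oneLoopDrift h)

/-- **★ THE END FROM THE EVERY-SHORT-SLOPE (Q1) NEEDS THE STRICT SEAM `s < c·s₀`** (then the slope `s/c < s₀` is available and §4 applies with equality in its seam).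
With `s = c·s₀` it fails (§8).  [cite: Balaban1987RG1, Thm 2 p.259 (first sentence) and (5.10) p.293] -/
theorem endpointExistence_of_shortSlopeDrift_constRemainder_cont {C : B12.Construction} (hgen : ForwardGenerated C β)
    {γ₀ s₀ M s c : ℝ} (hγ₀ : 0 < γ₀) (hc : 0 < c) (hshort : ShortSlopeDrift s₀ b) (hbd : ∀ k, b k ≤ M)
    (hrem : ConstRemainder β (fun k => c * b k) s γ₀) (hseam : s < c * s₀) (hcont : BetaContH γ₀ β) :
    EndpointExistence C := by
  have hc' : c ≠ 0 := hc.ne'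
  have e1 : c * (s₀ - s / c) = c * s₀ - s := by field_simp
  have hη : 0 < s₀ - s / c := by
    have h4 : 0 < c * (s₀ - s / c) := by rw [e1]; linarith
    exact pos_of_mul_pos_right h4 hc.le
  obtain ⟨A, hwin⟩ := hshort (s₀ - s / c) hη
  have e2 : s₀ - (s₀ - s / c) = s / c := by ring
  rw [e2] at hwin
  have e3 : c * (s / c) = s := by field_simp
  exact endpointExistence_of_windowDrift_constRemainder_cont hgen hγ₀ hc.le hwin hbd hrem (le_of_eq e3.symm) hcont

/-- **★ THE NESTING SUPPLIER OF THE EVERY-SHORT-SLOPE (Q1)** (the line's junction, generic in the family `β0 L k`): (AF-0-L) on the CLASS TAIL `{Lc^m : m ≥ m₀}` with ONE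
pair `(b, A)`, `0 < b` (`Beta.LargeL.LogGrowthLowerOn`), the cumulative nesting defect bounded for EVERY `m ≥ m₀` (constant `Cm m` free in `m`), and a crude two-sided bound
at base `Lc` ⟹ `ShortSlopeDrift (b·log Lc) (β0 Lc)`: for `η > 0` nest with `m ≥ max(m₀, A/(b·log Lc), A/η)` and read `q1_of_nesting` (slope `b·log Lc − A/m ≥ b·log Lc − η`).
Sequence algebra; nothing of Bałaban's asserted. [folklore] -/
theorem shortSlopeDrift_of_nesting {β0 : ℕ → ℕ → ℝ} {Lc m₀ : ℕ} (hLc : 2 ≤ Lc) (hm₀ : 0 < m₀) {b A M : ℝ} {Cm : ℕ → ℝ} (hb : 0 < b)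
    (hAF : LogGrowthLowerOn (fun L => ∃ m, m₀ ≤ m ∧ L = Lc ^ m) β0 b A)
    (hcum : ∀ m, m₀ ≤ m → CumDefectBdd m (β0 Lc) (β0 (Lc ^ m)) (Cm m)) (hbd : ∀ j, |β0 Lc j| ≤ M) :
    ShortSlopeDrift (b * Real.log (Lc : ℝ)) (β0 Lc) := by
  intro η hη
  have hLc1 : (1 : ℝ) < (Lc : ℝ) := by exact_mod_cast (lt_of_lt_of_le (by norm_num) hLc : 1 < Lc)
  have hlog : 0 < Real.log (Lc : ℝ) := Real.log_pos hLc1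
  have hbl : 0 < b * Real.log (Lc : ℝ) := mul_pos hb hlog
  obtain ⟨m, hm₀m, hm1, hm2⟩ : ∃ m : ℕ, m₀ ≤ m ∧ A / (b * Real.log (Lc : ℝ)) ≤ (m : ℝ) ∧ A / η ≤ (m : ℝ) := by
    refine ⟨max m₀ (max ⌈A / (b * Real.log (Lc : ℝ))⌉₊ ⌈A / η⌉₊), le_max_left _ _, ?_, ?_⟩
    · exact (Nat.le_ceil _).trans (Nat.cast_le.mpr ((le_max_left _ _).trans (le_max_right _ _)))
    · exact (Nat.le_ceil _).trans (Nat.cast_le.mpr ((le_max_right _ _).trans (le_max_right _ _)))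
  have hm : 0 < m := lt_of_lt_of_le hm₀ hm₀m
  have hmR : (0 : ℝ) < m := by exact_mod_cast hm
  have hlogpow : Real.log ((Lc ^ m : ℕ) : ℝ) = m * Real.log (Lc : ℝ) := by
    push_cast
    rw [Real.log_pow]
  have hfloor : 0 ≤ b * Real.log ((Lc ^ m : ℕ) : ℝ) - A := by
    rw [hlogpow]
    have h1 : A ≤ (m : ℝ) * (b * Real.log (Lc : ℝ)) := (div_le_iff₀ hbl).mp hm1
    have e : b * ((m : ℝ) * Real.log (Lc : ℝ)) = (m : ℝ) * (b * Real.log (Lc : ℝ)) := by ring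
    linarith
  have hAF' : LogGrowthLowerOn (fun L => L = Lc ^ m) β0 b A := fun L hL h2 k => hAF L ⟨m, hm₀m, hL⟩ h2 k
  have hq := q1_of_nesting hLc hm hAF' hfloor (hcum m hm₀m) hbd
  refine ⟨_, hq.of_le ?_⟩
  rw [slope_of_nesting hm b A]
  have hAm : A / (m : ℝ) ≤ η := by
    rw [div_le_iff₀ hmR, mul_comm]
    exact (div_le_iff₀ hη).mp hm2
  linarith

/-- … with LargeL's coefficient identified with Bałaban's slope, `stepBal 2 L = (11·2²/12π²)·log L` (`B12Normalization.stepBal_eq` BY NAME): the nesting supplier delivers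
`ShortSlopeDrift (stepBal 2 Lc) (β0 Lc)` — the (D1)-side currency §6 keys at the record. [cite: Balaban1987RG1, (0.20) p.256 and Thm 3 p.264] -/
theorem shortSlopeDrift_stepBal_of_nesting {β0 : ℕ → ℕ → ℝ} {Lc m₀ : ℕ} (hLc : 2 ≤ Lc) (hm₀ : 0 < m₀) {A M : ℝ} {Cm : ℕ → ℝ}
    (hAF : LogGrowthLowerOn (fun L => ∃ m, m₀ ≤ m ∧ L = Lc ^ m) β0 (11 * 2 ^ 2 / (12 * Real.pi ^ 2)) A)
    (hcum : ∀ m, m₀ ≤ m → CumDefectBdd m (β0 Lc) (β0 (Lc ^ m)) (Cm m)) (hbd : ∀ j, |β0 Lc j| ≤ M) :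
    ShortSlopeDrift (B12Normalization.stepBal 2 (Lc : ℝ)) (β0 Lc) := by
  rw [B12Normalization.stepBal_eq]
  exact shortSlopeDrift_of_nesting hLc hm₀ (by positivity) hAF hcum hbd

end OneSided

/-! ## §6 (edition 2, P2⁸) AT THE RECORD, KEYED ON THE NAMED NUMBERS `θ.cβ • beta0OfJs F κ` (θ-covariant; κ AFTER θ in the ∃-stub; DEF-1's letter READ, not edited) -/

section NamedJets

open Literature.MathematicalPhysics.QuantumFieldTheory.Balaban1983to89
open Literature.MathematicalPhysics.QuantumFieldTheory.Balaban1983to89.FlowStep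
open Literature.MathematicalPhysics.QuantumFieldTheory.Balaban1983to89.T4Continuum (T4Family)
open Literature.MathematicalPhysics.QuantumFieldTheory.Balaban1983to89.DagBinding (EndpointExistence)
open Literature.MathematicalPhysics.QuantumFieldTheory.Balaban1983to89.Beta.Drift (OneLoopDrift)
open Summit.QuantumFields.YangMills.Theorems.BalabanUVNodesK2JsOfRecord (StepColourData beta0OfJs BoxRemainder stepBal_L_pos)
open Summit.QuantumFields.YangMills.Theorems.BalabanUVNodesK2NamedJetsRemAt (ConstRemainder ScaleAnchor RemAt band_of_drift
  constRemainder_of_boxRemainder' scaleAnchor_of_boxRemainder)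

/-- **(Q1ᴶ) THE LINE's (D1)-SIDE TEXT, edition 2** — at an admissible proviso'd Stage-13 record, for every colour datum `κ` whose `θ.cβ`-scaled named numbers carry DEF-1's
letter `RemAt F κ θ hP θ.cβ` (the anchor PINS which numbers: `beta0OfJs_eq_of_remAt_adm`), the BARE named numbers `beta0OfJs F κ` obey (Q1) at EVERY slope short of
`stepBal 2 F.L` and a crude ceiling.  ONE-SIDED, NO value law, NO `OneShotLaw`, NO slope-exactly-`stepBal` claim; IMPLIED BY v4's stub 1′ `D1AtShadowingJets`
(`q1AtShadowingJets13_of_d1AtShadowingJets`).  Its intended supplier is §5's nesting theorem read at `β0 := L ↦ beta0OfJs ⟨L, …⟩ κ` (S-AF0-CLASS + S-NEST + S-BD).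
A hypothesis SHAPE, never a fact. [cite: Balaban1987RG1, (1.3) p.260, (2.12)–(2.14) p.268 and Thm 3 p.264] -/
def Q1AtShadowingJets13 : Prop :=
  ∀ (F : T4Family) (κ : StepColourData) (θ : Node00.Stage13HParams F 2) (hP : θ.Provisos₁₃SepCoPH F 2), θ.Admissible F 2 →
    RemAt F κ θ hP θ.cβ → ShortSlopeDrift (B12Normalization.stepBal 2 F.L) (beta0OfJs F κ) ∧ ∃ M : ℝ, ∀ k, beta0OfJs F κ k ≤ M

/-- **v4's STUB 1′ TEXT `D1AtShadowingJets` (two-sided drift AT slope `stepBal 2 F.L`) ⟹ (Q1ᴶ)**: the line's (D1)-side text is a WEAKENING of line 1′'s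
(ceiling `stepBal + 2A` from `band_of_drift`). [cite: Balaban1988RG2Cluster, Lemma 3 (2.38) p.20] -/
theorem q1AtShadowingJets13_of_d1AtShadowingJets
    (h : ∀ (F : T4Family) (κ : StepColourData) (θ : Node00.Stage13HParams F 2) (hP : θ.Provisos₁₃SepCoPH F 2), θ.Admissible F 2 →
      RemAt F κ θ hP θ.cβ → ∃ A : ℝ, OneLoopDrift (B12Normalization.stepBal 2 F.L) A (beta0OfJs F κ)) :
    Q1AtShadowingJets13 := fun F κ θ hP hθ hRem => by
  obtain ⟨A, hdrift⟩ := h F κ θ hP hθ hRem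
  refine ⟨shortSlopeDrift_of_oneLoopDrift hdrift, B12Normalization.stepBal 2 F.L + 2 * A, fun k => ?_⟩
  have h2 := (abs_le.mp (band_of_drift hdrift k)).2
  linarith

/-- **THE LETTER WITH SLACK `RemAtLT F κ θ hP c`** — DEF-1's `RemAt F κ θ hP c` (edition 3, `Thm/BalabanUVNodesK2NamedJetsRemAt`) with the cap STRICT, `s < c · stepBal 2 F.L`:
constant remainder + per-scale anchor + (C) at the scaled named numbers on a box `]0, γ₀] ⊆ ]0, θ.γ]`.  The conjuncts are DEF-1's predicates BY NAME; the letter of record is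
READ, not edited (DEF-1 stays its one declarer).  WHY: a (D1)-supplier short of the AF slope (nesting, §5) composes with the END only through a strict cap (§8's knife edge);
CRIT-1's linear letter and every-constant letters carry the slack for free (`remAtLT_of_remAtN`, `remAtLT_of_remAt_everyConst`).  A predicate, never a fact.
[cite: Balaban1987RG1, (2.12)–(2.14) p.268, (5.10) p.293 and (1.20)–(1.22) p.264] -/
def RemAtLT (F : T4Family) (κ : StepColourData) (θ : Node00.Stage13HParams F 2) (hP : θ.Provisos₁₃SepCoPH F 2) (c : ℝ) : Prop :=
  ∃ γ₀ s : ℝ, 0 < γ₀ ∧ γ₀ ≤ θ.γ ∧ s < c * B12Normalization.stepBal 2 F.L ∧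
    ConstRemainder (Node00.datumOfRecord₁₃SepCoPH F 2 θ hP).βfun (fun k => c * beta0OfJs F κ k) s γ₀ ∧
    ScaleAnchor (Node00.datumOfRecord₁₃SepCoPH F 2 θ hP).βfun (fun k => c * beta0OfJs F κ k) ∧
    BetaContH γ₀ (Node00.datumOfRecord₁₃SepCoPH F 2 θ hP).βfun

variable {F : T4Family} {κ : StepColourData} {θ : Node00.Stage13HParams F 2} {hP : θ.Provisos₁₃SepCoPH F 2}

/-- SLACK ⟹ LETTER OF RECORD: `RemAtLT F κ θ hP c → RemAt F κ θ hP c`. [folklore] -/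
theorem remAt_of_remAtLT {c : ℝ} (h : RemAtLT F κ θ hP c) : RemAt F κ θ hP c := by
  obtain ⟨γ₀, s, hγ₀, hγθ, hlt, hrem, hanch, hcont⟩ := h
  exact ⟨γ₀, s, hγ₀, hγθ, hlt.le, hrem, hanch, hcont⟩

/-- **CRIT-1's LINEAR LETTER CARRIES THE SLACK FOR FREE**: `BoxRemainder … C_r γ₀` with `C_r·γ₀ ≤ θ.cβ·stepBal 2 F.L` and (C) (the END-read conjuncts of `RemAtN`, text as in
DEF-1's `remAt_of_remAtN` minus the unread ceiling) ⟹ `RemAtLT F κ θ hP θ.cβ` — halve the window: `s := C_r·γ₀/2 < θ.cβ·stepBal` since `0 < θ.cβ·stepBal 2 F.L`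
(Stage-9 admissibility `hθ.toStage9.chart.1` and `stepBal_L_pos`). [folklore] -/
theorem remAtLT_of_remAtN (hθ : θ.Admissible F 2)
    (h : ∃ γ₀ Cr : ℝ, 0 < γ₀ ∧ γ₀ ≤ θ.γ ∧ 0 ≤ Cr ∧
      BoxRemainder (Node00.datumOfRecord₁₃SepCoPH F 2 θ hP).βfun (fun k => θ.cβ * beta0OfJs F κ k) Cr γ₀ ∧
      Cr * γ₀ ≤ θ.cβ * B12Normalization.stepBal 2 F.L ∧
      BetaContH γ₀ (Node00.datumOfRecord₁₃SepCoPH F 2 θ hP).βfun) :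
    RemAtLT F κ θ hP θ.cβ := by
  obtain ⟨γ₀, Cr, hγ₀, hγθ, hCr, hrem, hseam, hcont⟩ := h
  have hpos : 0 < θ.cβ * B12Normalization.stepBal 2 (F.L : ℝ) := mul_pos hθ.toStage9.chart.1 (stepBal_L_pos F (N := 2) (by norm_num))
  have hγ2 : 0 < γ₀ / 2 := by positivity
  have hle2 : γ₀ / 2 ≤ γ₀ := by linarith
  have hrem2 : BoxRemainder (Node00.datumOfRecord₁₃SepCoPH F 2 θ hP).βfun (fun k => θ.cβ * beta0OfJs F κ k) Cr (γ₀ / 2) := hrem.mono hle2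
  refine ⟨γ₀ / 2, Cr * (γ₀ / 2), hγ2, by linarith, ?_, constRemainder_of_boxRemainder' hrem2 hCr, scaleAnchor_of_boxRemainder hrem hCr hγ₀,
    fun k => (hcont k).mono (box_mono hle2 k)⟩
  have e : Cr * (γ₀ / 2) = Cr * γ₀ / 2 := by ring
  rw [e]
  linarith

/-- **EVERY-CONSTANT LETTERS CARRY THE SLACK TOO**: the letter of record plus «for every `s > 0` a window `]0, γ_s] ⊆ ]0, θ.γ]` with `ConstRemainder … s γ_s` and (C)» (the
every-slope ∕ (M) packages of ideas 5 and 7 read at constant grade) ⟹ `RemAtLT` (take `s := θ.cβ·stepBal 2 F.L / 2`). [folklore] -/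
theorem remAtLT_of_remAt_everyConst (hθ : θ.Admissible F 2) (h : RemAt F κ θ hP θ.cβ)
    (hev : ∀ s : ℝ, 0 < s → ∃ γs : ℝ, 0 < γs ∧ γs ≤ θ.γ ∧
      ConstRemainder (Node00.datumOfRecord₁₃SepCoPH F 2 θ hP).βfun (fun k => θ.cβ * beta0OfJs F κ k) s γs ∧
      BetaContH γs (Node00.datumOfRecord₁₃SepCoPH F 2 θ hP).βfun) :
    RemAtLT F κ θ hP θ.cβ := by
  obtain ⟨-, -, -, -, -, -, hanch, -⟩ := h
  have hpos : 0 < θ.cβ * B12Normalization.stepBal 2 (F.L : ℝ) := mul_pos hθ.toStage9.chart.1 (stepBal_L_pos F (N := 2) (by norm_num))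
  obtain ⟨γs, hγs, hγsθ, hrem, hcont⟩ := hev (θ.cβ * B12Normalization.stepBal 2 (F.L : ℝ) / 2) (by positivity)
  exact ⟨γs, _, hγs, hγsθ, by linarith, hrem, hanch, hcont⟩

/-- **THE LINE's (D4)-SIDE TEXT**: per admissible proviso'd tuple SOME colour datum carries the letter WITH SLACK at the tuple's scale (κ AFTER θ, CRIT-1's ruling;
`θ.cβ` carried, p592392).  Size XL (wall = NODE O) — the same XL wall as v4's stub 2′ `RemAtSomeJets`, of which it is the strict-cap sharpening; implied by CRIT-1's
linear 2′ᴺ (`remAtLT_of_remAtN`).  A hypothesis SHAPE, never a fact. [cite: Balaban1987RG1, (2.12)–(2.14) p.268, (5.10) p.293 and Thm 3 p.264] -/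
def RemAtLTSomeJets13 : Prop :=
  ∀ (F : T4Family) (θ : Node00.Stage13HParams F 2) (hP : θ.Provisos₁₃SepCoPH F 2), θ.Admissible F 2 → ∃ κ : StepColourData, RemAtLT F κ θ hP θ.cβ

/-- (Q1ᴶ)'s hypothesis is served by the slack letter. [folklore] -/
theorem remAtSomeJets_of_remAtLTSomeJets13 (h : RemAtLTSomeJets13) :
    ∀ (F : T4Family) (θ : Node00.Stage13HParams F 2) (hP : θ.Provisos₁₃SepCoPH F 2), θ.Admissible F 2 → ∃ κ : StepColourData, RemAt F κ θ hP θ.cβ :=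
  fun F θ hP hθ => by
    obtain ⟨κ, hκ⟩ := h F θ hP hθ
    exact ⟨κ, remAt_of_remAtLT hκ⟩

/-- **★★ THE NESTING LINE's COMPOSITION, edition 2 (kernel-checked, no sorry): (Q1ᴶ) → (D4 with slack) → THE CRUX DECL BY NAME**
(`Summit.QuantumFields.YangMills.Theses.BalabanUVNodes.EndpointGivenBR13SepCoPH`).  Per record: κ and the slack letter from `h₂`; (Q1) at every short slope + ceiling of the
bare named numbers from `h₁` (fed the letter via `remAt_of_remAtLT`); the END by §5's `endpointExistence_of_shortSlopeDrift_constRemainder_cont` at the datum's `fwd` with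
`c := θ.cβ > 0` (Stage-9 admissibility).  The item's unity ∕ (B) ∕ window hypotheses are unused (as in v3∕v4).  ONE-SIDED throughout: no `OneLoopDrift`, no value law, no
`OneShotLaw`, no `D1Residue`.  CONDITIONAL on the two displayed hypothesis shapes; K2⁷ NOT closed; nothing of Bałaban's asserted; Clay YM NOT proved.
[cite: Balaban1987RG1, Thm 2 p.259 (first sentence), (5.10) p.293 and (2.12)–(2.14) p.268] -/
theorem EndpointGivenBR13SepCoPH_of_nestingJets (h₁ : Q1AtShadowingJets13) (h₂ : RemAtLTSomeJets13) :
    Summit.QuantumFields.YangMills.Theses.BalabanUVNodes.EndpointGivenBR13SepCoPH := by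
  intro F θ hP _hU hθ _hB _hwin
  obtain ⟨κ, hLT⟩ := h₂ F θ hP hθ
  obtain ⟨hshort, M, hbd⟩ := h₁ F κ θ hP hθ (remAt_of_remAtLT hLT)
  obtain ⟨γ₀, s, hγ₀, -, hlt, hrem, -, hcont⟩ := hLT
  exact endpointExistence_of_shortSlopeDrift_constRemainder_cont (Node00.datumOfRecord₁₃SepCoPH F 2 θ hP).fwd hγ₀ hθ.toStage9.chart.1
    hshort hbd hrem hlt hcont

/-- … and v4's LINE 1′ PAIR (stub 1′ `D1AtShadowingJets` + a slack 2′) closes through the SAME one-sided socket — the nesting line and line 1′ share the (D4)-side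
and differ only in the (D1)-side currency ((Q1ᴶ) vs two-sided drift at slope `stepBal`). [folklore] -/
theorem EndpointGivenBR13SepCoPH_of_d1AtShadowingJets_remAtLT
    (h₁ : ∀ (F : T4Family) (κ : StepColourData) (θ : Node00.Stage13HParams F 2) (hP : θ.Provisos₁₃SepCoPH F 2), θ.Admissible F 2 →
      RemAt F κ θ hP θ.cβ → ∃ A : ℝ, OneLoopDrift (B12Normalization.stepBal 2 F.L) A (beta0OfJs F κ))
    (h₂ : RemAtLTSomeJets13) :
    Summit.QuantumFields.YangMills.Theses.BalabanUVNodes.EndpointGivenBR13SepCoPH :=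
  EndpointGivenBR13SepCoPH_of_nestingJets (q1AtShadowingJets13_of_d1AtShadowingJets h₁) h₂

end NamedJets

/-! ## §7 (edition 2, P1⁸ stated plainly) In the CONVERGENT regime S-NEST ⟺ exact nesting of the stationary values -/

section Stationary

/-- **VALUE LAWS WITH SUMMABLE TRANSIENTS AT BOTH BLOCKS AND EXACTLY NESTED STATIONARY VALUES ⟹ S-NEST**: `b_j = σ + τ_j`, `B_j = m·σ + T_j`,
`|Σ_{j<k} τ_j| ≤ t`, `|Σ_{j<k} T_j| ≤ t′` ⟹ `CumDefectBdd m b B (t + t′)`. [folklore] -/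
theorem cumDefectBdd_of_stationary_transients {m : ℕ} {σ : ℝ} {τ T : ℕ → ℝ} {t t' : ℝ}
    (hτ : ∀ k, |∑ j ∈ Finset.range k, τ j| ≤ t) (hT : ∀ k, |∑ j ∈ Finset.range k, T j| ≤ t') :
    CumDefectBdd m (fun j => σ + τ j) (fun j => (m : ℝ) * σ + T j) (t + t') := by
  intro k
  have e : ∑ j ∈ Finset.range (m * k), (σ + τ j) - ∑ j ∈ Finset.range k, ((m : ℝ) * σ + T j)
      = ∑ j ∈ Finset.range (m * k), τ j - ∑ j ∈ Finset.range k, T j := by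
    simp only [Finset.sum_add_distrib, Finset.sum_const, Finset.card_range, nsmul_eq_mul]
    push_cast
    ring
  show |∑ j ∈ Finset.range (m * k), (σ + τ j) - ∑ j ∈ Finset.range k, ((m : ℝ) * σ + T j)| ≤ t + t'
  rw [e]
  exact (abs_sub _ _).trans (add_le_add (hτ (m * k)) (hT k))

/-- **… AND CONVERSELY, S-NEST WITH SUMMABLE TRANSIENTS AT BOTH BLOCKS FORCES EXACT NESTING `Σ = m·σ`** (the defect's linear part `k·(m·σ − Σ)` must vanish).  So in the
convergent regime S-NEST is road «FP»'s additivity `β∞(L^m) = m·β∞(L)` on powers of `L` plus transient death at BOTH blocks — CRIT-2 2b's P1⁸, kernel-exact; independent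
content only through a direct (coboundary ∕ Schur) proof of S-NEST that does not pass through convergence. [folklore] -/
theorem stationary_nesting_of_cumDefectBdd {m : ℕ} {σ S : ℝ} {τ T : ℕ → ℝ} {t t' C : ℝ}
    (hτ : ∀ k, |∑ j ∈ Finset.range k, τ j| ≤ t) (hT : ∀ k, |∑ j ∈ Finset.range k, T j| ≤ t')
    (h : CumDefectBdd m (fun j => σ + τ j) (fun j => S + T j) C) : S = m * σ := by
  by_contra hne
  have hx : 0 < |(m : ℝ) * σ - S| := abs_pos.mpr (sub_ne_zero.mpr (fun h' => hne h'.symm))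
  obtain ⟨k, hk⟩ := exists_nat_gt ((C + t + t') / |(m : ℝ) * σ - S|)
  have hbound : (k : ℝ) * |(m : ℝ) * σ - S| ≤ C + t + t' := by
    have e : (k : ℝ) * ((m : ℝ) * σ - S)
        = (∑ j ∈ Finset.range (m * k), (σ + τ j) - ∑ j ∈ Finset.range k, (S + T j))
          - ∑ j ∈ Finset.range (m * k), τ j + ∑ j ∈ Finset.range k, T j := by
      simp only [Finset.sum_add_distrib, Finset.sum_const, Finset.card_range, nsmul_eq_mul]
      push_cast
      ring
    have h1 : |∑ j ∈ Finset.range (m * k), (σ + τ j) - ∑ j ∈ Finset.range k, (S + T j)| ≤ C := h k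
    have h2 := hτ (m * k)
    have h3 := hT k
    have habs : |(k : ℝ) * ((m : ℝ) * σ - S)| ≤ C + t + t' := by
      rw [e]
      refine (abs_add_le _ _).trans ?_
      refine (add_le_add (abs_sub _ _) le_rfl).trans ?_
      linarith
    rw [abs_mul, Nat.abs_cast] at habs
    exact habs
  have hk' : C + t + t' < (k : ℝ) * |(m : ℝ) * σ - S| := by
    have := (div_lt_iff₀ hx).mp hk
    linarith
  linarith

end Stationary

/-! ## §8 (edition 2) THE KNIFE EDGE — why the every-short-slope (Q1) needs the STRICT cap: with `s = c·s₀` the END's necessary currency fails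

NEAREST PRIOR ART IN THE TREE (edition 2.1 note, docstring only): the β sub-cell's `Summits/QuantumFields/BalabanUV/Beta/RemainderThresholdSharp.lean`
(row D4, an4 g30, p198581) proves the COMPLEMENTARY side of the same threshold — with the TWO-SIDED `Beta.Drift.OneLoopDrift b A c` the cap `rr ≤ b` is
SHARP AND ATTAINED (`endpointExistence_iff : EndpointExistence (modelOf (betaG c rr)) ↔ rr ≤ b`, `END_false_with_relaxed_threshold`), and under the
LINEAR g_k-form no numeric restriction is needed (`endpointExistence_of_drift_af1`).  The witness below shows that with only the ONE-SIDED every-short-slope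
currency `ShortSlopeDrift s₀` the boundary value `s = c·s₀` itself is lost; and the printed constant-form chain's located ε₁-choice
`Beta.RemainderChainKP.exists_eps1_lt_and_le` (`ε₁ * K < b * Real.log L`) already delivers the STRICT seam, so `RemAtLT` (§6) costs the (D4)-supplier nothing.
Neither module is imported here (cell-tree / not needed); they are cited BY NAME. -/

section KnifeEdge

open Literature.MathematicalPhysics.QuantumFieldTheory.Balaban1983to89
open Literature.MathematicalPhysics.QuantumFieldTheory.Balaban1983to89.FlowStep
open Literature.MathematicalPhysics.QuantumFieldTheory.Balaban1983to89.FlowStepRuns (BetaPartialSumsLowerH)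
open Literature.MathematicalPhysics.QuantumFieldTheory.Balaban1983to89.B12Beta (HistBox)
open Summit.QuantumFields.YangMills.Theorems.BalabanUVNodesK2NamedJetsRemAt (ConstRemainder)

/-- The knife-edge reference profile `bKnife j = 1 − 1/(j+1)` (slope-`1` in Cesàro mean, harmonic deficit). [folklore] -/
noncomputable def bKnife (j : ℕ) : ℝ := 1 - 1 / ((j : ℝ) + 1)

/-- The knife-edge β (history-independent): `betaKnife j _ = −1/(j+1) = 1·bKnife j − 1` — remainder EXACTLY at the cap `s = c·s₀ = 1`. [folklore] -/
noncomputable def betaKnife : HBeta := fun j _ => -(1 / ((j : ℝ) + 1))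

/-- The profile obeys (Q1) at EVERY slope short of `1` (defect `⌈1/η⌉`). [folklore] -/
theorem shortSlopeDrift_bKnife : ShortSlopeDrift 1 bKnife := by
  intro η hη
  refine ⟨(⌈1 / η⌉₊ : ℝ), fun k n hkn => ?_⟩
  have hpt : ∀ j : ℕ, 1 / ((j : ℝ) + 1) ≤ η + (if j < ⌈1 / η⌉₊ then (1 : ℝ) else 0) := by
    intro j
    have hj1 : (0 : ℝ) < (j : ℝ) + 1 := by positivity
    by_cases hj : j < ⌈1 / η⌉₊
    · rw [if_pos hj]
      have h1 : 1 / ((j : ℝ) + 1) ≤ 1 := by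
        rw [div_le_iff₀ hj1]
        linarith
      linarith
    · rw [if_neg hj, add_zero, div_le_iff₀ hj1]
      have hKj : (⌈1 / η⌉₊ : ℝ) ≤ j := by exact_mod_cast Nat.le_of_not_lt hj
      have h1 : 1 / η ≤ (j : ℝ) + 1 := by linarith [Nat.le_ceil (1 / η)]
      have h2 : 1 ≤ ((j : ℝ) + 1) * η := (div_le_iff₀ hη).mp h1
      have e : η * ((j : ℝ) + 1) = ((j : ℝ) + 1) * η := mul_comm _ _
      linarith
  have hsum : ∑ j ∈ Finset.Ico k n, (1 / ((j : ℝ) + 1)) ≤ ∑ j ∈ Finset.Ico k n, (η + (if j < ⌈1 / η⌉₊ then (1 : ℝ) else 0)) :=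
    Finset.sum_le_sum fun j _ => hpt j
  have hite : ∑ j ∈ Finset.Ico k n, (if j < ⌈1 / η⌉₊ then (1 : ℝ) else 0) ≤ (⌈1 / η⌉₊ : ℝ) := by
    rw [Finset.sum_boole]
    have hsub : (Finset.Ico k n).filter (fun j => j < ⌈1 / η⌉₊) ⊆ Finset.range ⌈1 / η⌉₊ := by
      intro j hj
      rw [Finset.mem_filter] at hj
      exact Finset.mem_range.mpr hj.2
    exact_mod_cast (Finset.card_le_card hsub).trans (Finset.card_range _).le
  have hsplit1 : ∑ j ∈ Finset.Ico k n, (η + (if j < ⌈1 / η⌉₊ then (1 : ℝ) else 0))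
      = η * ((n : ℝ) - k) + ∑ j ∈ Finset.Ico k n, (if j < ⌈1 / η⌉₊ then (1 : ℝ) else 0) := by
    rw [Finset.sum_add_distrib, Finset.sum_const, Nat.card_Ico, nsmul_eq_mul, Nat.cast_sub hkn]
    ring
  have hsplit2 : ∑ j ∈ Finset.Ico k n, bKnife j = ((n : ℝ) - k) - ∑ j ∈ Finset.Ico k n, (1 / ((j : ℝ) + 1)) := by
    simp only [bKnife]
    rw [Finset.sum_sub_distrib, Finset.sum_const, Nat.card_Ico, nsmul_eq_mul, Nat.cast_sub hkn, mul_one]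
  rw [hsplit2]
  have e1 : (1 - η) * ((n : ℝ) - k) = ((n : ℝ) - k) - η * ((n : ℝ) - k) := by ring
  linarith

/-- … has the crude ceiling `bKnife ≤ 1`. [folklore] -/
theorem bKnife_le_one (j : ℕ) : bKnife j ≤ 1 := by
  unfold bKnife
  have : 0 ≤ 1 / ((j : ℝ) + 1) := by positivity
  linarith

/-- … and `betaKnife` shadows `1 • bKnife` with the constant remainder EXACTLY at the cap, `s = 1 = c·s₀`, on every box. [folklore] -/
theorem constRemainder_betaKnife (γ₀ : ℝ) : ConstRemainder betaKnife (fun k => 1 * bKnife k) 1 γ₀ := by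
  intro k p _hp
  show |-(1 / ((k : ℝ) + 1)) - 1 * (1 - 1 / ((k : ℝ) + 1))| ≤ 1
  have e : -(1 / ((k : ℝ) + 1)) - 1 * (1 - 1 / ((k : ℝ) + 1)) = -1 := by ring
  rw [e]
  norm_num

/-- … and (C) trivially (each `betaKnife j` is constant in the history). [folklore] -/
theorem betaContH_betaKnife (γ : ℝ) : BetaContH γ betaKnife := fun _k => continuousOn_const

/-- **THE KNIFE EDGE**: yet for every `M` and every box `γ > 0`, `¬ BetaPartialSumsLowerH M γ betaKnife` — the partial sums `−Σ_{j<n} 1/(j+1)` run to `−∞`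
(`Real.tendsto_sum_range_one_div_nat_succ_atTop`).  Since (A-ps) is NECESSARY for the END along realised runs (`FlowStepRuns` §7), a (D1)-supplier at every slope SHORT
of `s₀` cannot close through a cap met with equality: the STRICT cap of §6's `RemAtLT` is load-bearing, not cosmetic. [folklore] -/
theorem not_betaPartialSumsLowerH_betaKnife {γ : ℝ} (hγ : 0 < γ) (M : ℝ) : ¬ BetaPartialSumsLowerH M γ betaKnife := by
  intro h
  have hev := (Filter.tendsto_atTop.mp Real.tendsto_sum_range_one_div_nat_succ_atTop) (M + 1)
  obtain ⟨n, hn⟩ := hev.exists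
  have hps := h (fun _ => γ) (fun _ => ⟨hγ, le_rfl⟩) 0 n (Nat.zero_le n)
  have e : ∑ j ∈ Finset.Ico 0 n, betaKnife j (prefixOf (fun _ => γ) j)
      = -∑ i ∈ Finset.range n, (1 / ((i : ℝ) + 1)) := by
    rw [← Finset.range_eq_Ico, ← Finset.sum_neg_distrib]
    rfl
  rw [e] at hps
  linarith

end KnifeEdge

/-! ## §9 (EDITION 3 — P1⁸ ∕ F3 made concrete) BOUNDED SEMIGROUP TRANSFER (BST) and the COARSE-LEG bookkeeping

CRIT-2 ROUND 2d left the card's fate on P1⁸: S-NEST = `CumDefectBdd m (β0 Lc) (β0 (Lc^m)) C` is, read through CONVERGENCE, equivalent to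
Q-asym1-5 (iii) (value road) — «the one independent bet = a DIRECT boundedness proof (F3), a proof task».  Edition 3 names that proof task:

* **BST** (bounded semigroup transfer, sequence level): `|Σ_{j<k} β⁰_{j+1}(L) − μ₁(L^k)| ≤ T` for all `k ≥ 1`, where `μ₁(n) = β⁰_1(n)` is the
  GENUINE FIRST-STEP coefficient at blocking factor `n` (scheme (S3) of ASYM §4″: one averaging `Q_n`, NOT the composite `(Q_L)^k`).  It is
  `OneShotTelescope`'s (T1) `hTel` with the EXACT `=` (dead by data for `B :=` the first-step family: `e(k=0) = 0.210 ± 0.018`, ASYM §4″ v2.0)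
  replaced by a BOUNDED defect, and it is NOT `MarginalTelescoping`/`SeparationRate` (those compare the flow with the COMPOSED coefficient,
  schemes (S1)/(S2), which agree exactly: `HessianTelescopingKKT.D1Tel`).
* CONSEQUENCES (kernel, below): BST(L) ∧ BST(L^m) ⟹ S-NEST with `C = T₁ + T₂` (`cumDefectBdd_of_bst`); BST + the two-sided FIRST-STEP law along
  the powers (= (T2), in cone: `OneShotTelescope.hB_of_logGrowth`, `LargeL` at `k = 0`, `ComposedRoad.logGrowth_stepBal`) ⟹ `OneLoopDrift` at slope
  `b·log L` with defect `A + T` (`oneLoopDrift_of_bst_logGrowth`) ⟹ v4's stub-1′ currency ⟹ the crux BY NAME through §6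
  (`EndpointGivenBR13SepCoPH_of_bst_remAtLT`).  Under BST the nesting line's (AF-0-L)-at-one-large-block input COLLAPSES to `k = 0` data only.
  HONESTY (`bstSeq_of_oneLoopDrift`): with `μ₁` EXISTENTIALLY quantified BST + first-step law is a REWRITING of two-sided drift — the content of
  BST is that `μ₁` is THE first-step family, a one-shot object for which the window machinery of `LargeL`/`ComposedRoad` §1 is designed.
* MECHANISM for BST (the COARSE-LEG LEMMA — informal, NOT kernel-checked; estimate class named in the card): in the KKT letters of
  `Beta/LogDetHessian` (`Π = −½[tr(K₀⁻¹∂²K) − tr((K₀⁻¹∂K)²)]`, `K = [[Δ, C̃ᵀ],[C̃, 0]]`, `K₀⁻¹ = [[𝒢, ℋ],[ℋᵀ, −𝒮]]`) the one-shot one-loop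
  marginal coefficients of the composite `(Q_L)^k` and of `Q_{L^k}` (same fine lattice, same unit lattice, same bare action) differ by a
  finite sum of trace terms EACH CARRYING ≥ 1 COARSE LEG (`ℋ`, `𝒮`, `∂C̃`, `∂²C̃`) or a Ward contact: (0) the linearised averagings agree modulo
  pure gauge (cone: [B5] (1.4)–(1.5), ASYM (ii)) — `C̃¹ = C̃²∘S⁻¹` with a UNIPOTENT SHEAR `S = 1 + N`, `H₀N = 0` (`N = d∘E∘κ̃`, `κ̃` the
  gauge-invariant mean flux between the two contour systems), whence `SᵀH₀S = H₀` (`shear_conj_of_mul_eq_zero`) and `S : ker C̃² → ker C̃¹`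
  (`kernel_transport`); (1) so the constraint-free ('hard') blocks `𝒢` of the two schemes are conjugate up to a gauge term carrying `κ̃`
  (a coarse functional); (2) in the expansion of `Π` the ONLY coarse-leg-free terms are `tr(𝒢∂²Δ)` and `tr((𝒢∂Δ)²)`
  (`kkt_trace_d2_split`, `kkt_trace_sq_split` — kernel-checked block bookkeeping); their scheme difference is pure gauge at the vertex, i.e. a
  Ward contact.  Abelian check: for U(1) step (0) is exact to all orders and there are no defect vertices — BST with `T = 0` (`bst_abelian`,
  = `AbelianRung` in cone; data: abelian parts `0.7470703` in BOTH schemes).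
HONEST FRAMING: Clay YM mass gap NOT proved by any of this; R4 closes only the conditional finite-𝕋⁴ rung `BalabanLadder.UV`; NODE O = [B12] Thm 2
(0.31) p.259 is unproved in print; nothing of Bałaban's is asserted; BST is a HYPOTHESIS SHAPE whose proof (the coarse-leg estimate) is NOT done here. -/

section BST

open Literature.MathematicalPhysics.QuantumFieldTheory.Balaban1983to89
open Literature.MathematicalPhysics.QuantumFieldTheory.Balaban1983to89.T4Continuum (T4Family)
open Literature.MathematicalPhysics.QuantumFieldTheory.Balaban1983to89.Beta.Drift (OneLoopDrift)
open Summit.QuantumFields.YangMills.Theorems.BalabanUVNodesK2JsOfRecord (StepColourData beta0OfJs)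
open Summit.QuantumFields.YangMills.Theorems.BalabanUVNodesK2NamedJetsRemAt (RemAt)

variable {b : ℕ → ℝ} {μ₁ : ℕ → ℝ} {β : ℕ → ℕ → ℝ} {L m : ℕ} {T T₁ T₂ A s : ℝ}

/-- **BST, sequence form**: the partial sums of `b` (the base-`L` flow coefficients) stay within `T` of `μ₁ (L^k)` for every `k ≥ 1`
(`μ₁ n` = the first-step coefficient at blocking factor `n`).  A hypothesis SHAPE, never a fact.
[cite: Balaban1987RG1, (1.3) p.260 and (4.35)–(4.36) p.290] -/
def BSTSeq (b : ℕ → ℝ) (L : ℕ) (μ₁ : ℕ → ℝ) (T : ℝ) : Prop :=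
  ∀ k : ℕ, 1 ≤ k → |∑ j ∈ Finset.range k, b j - μ₁ (L ^ k)| ≤ T

/-- **BST for a blocking-factor-indexed family** `β n j = β⁰_{j+1}(n)`: the first-step family is `μ₁ n := β n 0` — THE genuine one-step
coefficient at factor `n`, not an auxiliary sequence. [cite: Balaban1987RG1, (1.3) p.260] -/
def BST (β : ℕ → ℕ → ℝ) (L : ℕ) (T : ℝ) : Prop :=
  BSTSeq (β L) L (fun n => β n 0) T

theorem BSTSeq.nonneg (h : BSTSeq b L μ₁ T) : 0 ≤ T :=
  (abs_nonneg _).trans (h 1 le_rfl)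

theorem BST.nonneg (h : BST β L T) : 0 ≤ T := BSTSeq.nonneg h

/-- The `k = 1` instance of BST is automatic (`Σ_{j<1} β L j = β (L^1) 0`). [folklore] -/
theorem bst_one (β : ℕ → ℕ → ℝ) (L : ℕ) : |∑ j ∈ Finset.range 1, β L j - β (L ^ 1) 0| = 0 := by
  simp

/-- EXACT telescoping onto the first-step family (`OneShotTelescope`'s `hTel` with `B n := β n 0`) is BST with `T = 0`. [folklore] -/
theorem bst_of_hTel (hTel : ∀ k : ℕ, ∑ j ∈ Finset.range k, β L j = β (L ^ k) 0) : BST β L 0 := by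
  intro k _hk
  rw [hTel k, sub_self, abs_zero]

/-- **ABELIAN RUNG**: for U(1) (`abelianCoeff n j = (n⁴−1)/(4n^{4(j+1)})`, `Beta.Certified`) BST holds with `T = 0` — `k` steps of block `L`
sum EXACTLY to the first step of block `L^k` (§1's `abelian_nesting_exact` at `(n, k) := (k, 0)`).  Data: abelian parts `0.7470703` in both
schemes of the (2,2)∕(4,1) comparison (ASYM §4″ v2.0). [folklore] -/
theorem bst_abelian (hL : L ≠ 0) : BST (fun n j => (abelianCoeff n j : ℝ)) L 0 := by
  intro k _hk
  have h := abelian_nesting_exact hL k 0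
  simp only [Nat.mul_zero, Nat.zero_add] at h
  have h' : ∑ i ∈ Finset.range k, (abelianCoeff L i : ℝ) = (abelianCoeff (L ^ k) 0 : ℝ) := by exact_mod_cast h
  simp [h']

/-- **BST AT TWO BASES ⟹ S-NEST (P1⁸)**: BST at base `L` (constant `T₁`) and at base `L^m` (constant `T₂`) give the bounded cumulative nesting
defect `CumDefectBdd m (β L) (β (L^m)) (T₁ + T₂)` — both partial sums are compared with the SAME first step `β (L^{mk}) 0`. [folklore] -/
theorem cumDefectBdd_of_bst (hm : 0 < m) (h₁ : BST β L T₁) (h₂ : BST β (L ^ m) T₂) :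
    CumDefectBdd m (β L) (β (L ^ m)) (T₁ + T₂) := by
  intro k
  rcases Nat.eq_zero_or_pos k with hk | hk
  · subst hk
    simp only [Nat.mul_zero, Finset.range_zero, Finset.sum_empty, sub_self, abs_zero]
    linarith [h₁.nonneg, h₂.nonneg]
  · have e₁ := h₁ (m * k) (Nat.mul_pos hm hk)
    have e₂ := h₂ k hk
    have hpow : (L ^ m) ^ k = L ^ (m * k) := (pow_mul L m k).symm
    rw [hpow] at e₂
    rw [abs_le] at e₁ e₂ ⊢
    constructor <;> linarith [e₁.1, e₁.2, e₂.1, e₂.2]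

/-- **BST + TWO-SIDED FIRST-STEP LAW ALONG THE POWERS ⟹ TWO-SIDED DRIFT**: `|μ₁(L^k) − s·k| ≤ A` (`k ≥ 1`, `A ≥ 0`) and BST give
`OneLoopDrift s (A + T) b`. (`OneShotTelescope.oneLoopDrift_of_telescope_pow` with the exact telescoping replaced by the bounded transfer.)
[folklore] -/
theorem oneLoopDrift_of_bstSeq (h : BSTSeq b L μ₁ T) (hA : 0 ≤ A) (hμ : ∀ k : ℕ, 1 ≤ k → |μ₁ (L ^ k) - s * k| ≤ A) :
    OneLoopDrift s (A + T) b := by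
  intro k
  rcases Nat.eq_zero_or_pos k with hk | hk
  · subst hk
    simp only [Finset.range_zero, Finset.sum_empty, Nat.cast_zero, mul_zero, sub_self, abs_zero]
    linarith [h.nonneg]
  · have e₁ := h k hk
    have e₂ := hμ k hk
    rw [abs_le] at e₁ e₂ ⊢
    constructor <;> linarith [e₁.1, e₁.2, e₂.1, e₂.2]

/-- `log (L^k) = k·log L` in the cast form used below. [folklore] -/
theorem log_natPow' (L k : ℕ) : Real.log (((L ^ k : ℕ) : ℝ)) = (k : ℝ) * Real.log L := by
  rw [Nat.cast_pow, Real.log_pow]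

/-- **BST + (T2) IN THE BLOCKING-FACTOR FORM** `|β n 0 − b₀·log n| ≤ A` (`n ≥ 2`; `LargeL.LogGrowth` read at `k = 0`, `OneShotTelescope.hB_of_logGrowth`)
⟹ `OneLoopDrift (b₀·log L) (A + T) (β L)` for `L ≥ 2`. [folklore] -/
theorem oneLoopDrift_of_bst_logGrowth {b₀ : ℝ} (hL : 2 ≤ L) (hA : 0 ≤ A) (h : BST β L T)
    (hB : ∀ n : ℕ, 2 ≤ n → |β n 0 - b₀ * Real.log n| ≤ A) : OneLoopDrift (b₀ * Real.log L) (A + T) (β L) := by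
  refine oneLoopDrift_of_bstSeq h hA fun k hk => ?_
  have hLk : 2 ≤ L ^ k :=
    calc 2 ≤ L ^ 1 := by simpa using hL
      _ ≤ L ^ k := Nat.pow_le_pow_right (by omega) hk
  have e := hB (L ^ k) hLk
  rwa [log_natPow', show b₀ * ((k : ℝ) * Real.log L) = b₀ * Real.log L * k by ring] at e

/-- … and with the slope written as `B12Normalization.stepBal N L` (`= 11N²/(12π²)·log L`, `stepBal_eq`): the first-step law
`|μ₁ n − stepBal N n| ≤ A` (`n ≥ 2`) + BST ⟹ `OneLoopDrift (stepBal N L) (A + T) b`. [folklore] -/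
theorem oneLoopDrift_stepBal_of_bstSeq {N : ℝ} (hL : 2 ≤ L) (hA : 0 ≤ A) (h : BSTSeq b L μ₁ T)
    (hμ : ∀ n : ℕ, 2 ≤ n → |μ₁ n - B12Normalization.stepBal N n| ≤ A) :
    OneLoopDrift (B12Normalization.stepBal N L) (A + T) b := by
  refine oneLoopDrift_of_bstSeq h hA fun k hk => ?_
  have hLk : 2 ≤ L ^ k :=
    calc 2 ≤ L ^ 1 := by simpa using hL
      _ ≤ L ^ k := Nat.pow_le_pow_right (by omega) hk
  have e := hμ (L ^ k) hLk
  have hs : B12Normalization.stepBal N ((L ^ k : ℕ) : ℝ) = B12Normalization.stepBal N L * k := by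
    rw [B12Normalization.stepBal_eq, B12Normalization.stepBal_eq, log_natPow']
    ring
  rwa [hs] at e

/-- **HONESTY LEMMA**: with `μ₁` free, BST + first-step law is only a REWRITING of two-sided drift — any `b` with `OneLoopDrift s A b` satisfies
`BSTSeq b L μ₁ A` for the ARTIFICIAL family `μ₁ n := s·(Nat.log L n)` (`L ≥ 2`).  The content of BST is the IDENTITY of `μ₁` (the genuine first-step
family, a definable one-shot object), not the inequality shape. [folklore] -/
theorem bstSeq_of_oneLoopDrift (hL : 2 ≤ L) (h : OneLoopDrift s A b) :
    BSTSeq b L (fun n => s * (Nat.log L n : ℕ)) A := by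
  intro k _hk
  have hlog : Nat.log L (L ^ k) = k := Nat.log_pow (by omega) k
  simp only [hlog]
  exact h k

/-- **★ EDITION-3 COMPOSITION (kernel-checked, no sorry): BST AT THE RECORD's NAMED NUMBERS + FIRST-STEP LAW ALONG THE POWERS + THE SLACK LETTER ⟹ THE CRUX
DECL BY NAME.**  Per admissible proviso'd Stage-13 tuple and colour datum carrying DEF-1's letter: SOME first-step family `μ₁` with BST (constant `T`) for the
bare named numbers `beta0OfJs F κ` at base `F.L` and the two-sided first-step law `|μ₁ n − stepBal 2 n| ≤ A` (`n ≥ 2`) — then two-sided drift at slope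
`stepBal 2 F.L` (`oneLoopDrift_stepBal_of_bstSeq`), and §6's `EndpointGivenBR13SepCoPH_of_d1AtShadowingJets_remAtLT` closes.  The INTENDED `μ₁` is the
genuine first-step coefficient of the one-step map with blocking factor `n` (same fine action, colour datum `κ`); with `μ₁` existential the hypothesis is
v4's stub 1′ currency re-keyed (`bstSeq_of_oneLoopDrift`), so this junction adds NO strength at the record — it records WHERE the supplier's work goes
(BST for the genuine family = the coarse-leg lemma; (T2) = the `k = 0` window road, in cone).  CONDITIONAL on the displayed hypothesis shapes; K2⁷ NOT
closed; nothing of Bałaban's asserted; Clay YM NOT proved. [cite: Balaban1987RG1, Thm 2 p.259 (first sentence), (1.3) p.260, (5.10) p.293] -/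
theorem EndpointGivenBR13SepCoPH_of_bst_remAtLT
    (h₁ : ∀ (F : T4Family) (κ : StepColourData) (θ : Node00.Stage13HParams F 2) (hP : θ.Provisos₁₃SepCoPH F 2), θ.Admissible F 2 →
      RemAt F κ θ hP θ.cβ → ∃ (μ₁ : ℕ → ℝ) (T A : ℝ), 0 ≤ A ∧ BSTSeq (beta0OfJs F κ) F.L μ₁ T ∧
        ∀ n : ℕ, 2 ≤ n → |μ₁ n - B12Normalization.stepBal 2 n| ≤ A)
    (h₂ : RemAtLTSomeJets13) :
    Summit.QuantumFields.YangMills.Theses.BalabanUVNodes.EndpointGivenBR13SepCoPH :=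
  EndpointGivenBR13SepCoPH_of_d1AtShadowingJets_remAtLT (fun F κ θ hP hθ hRem => by
    obtain ⟨μ₁, T, A, hA, hbst, hμ⟩ := h₁ F κ θ hP hθ hRem
    exact ⟨A + T, oneLoopDrift_stepBal_of_bstSeq F.hL.2 hA hbst hμ⟩) h₂

end BST

/-! ### §9b The coarse-leg bookkeeping in a finite-dimensional KKT model (steps (0)–(2) of the mechanism; [folklore] linear algebra) -/

section CoarseLeg

open scoped Matrix

variable {p q : Type*} [Fintype p] [Fintype q]

/-- The trace of a block matrix is the sum of the traces of its diagonal blocks. [folklore] -/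
theorem trace_fromBlocks_eq (A : Matrix p p ℝ) (B : Matrix p q ℝ) (C : Matrix q p ℝ) (D : Matrix q q ℝ) :
    Matrix.trace (Matrix.fromBlocks A B C D) = Matrix.trace A + Matrix.trace D := by
  simp [Matrix.trace, Fintype.sum_sum_type]

omit [Fintype q] in
/-- **STEP (0), SHEAR CONJUGATION**: if the quadratic form `H` (symmetric) kills the shear direction, `H * N = 0` (`N = d∘E∘κ̃` is pure gauge and `H`
is the Hessian of a gauge-INVARIANT action at a critical configuration), then the unipotent shear `S = 1 + N` preserves `H`: `Sᵀ H S = H`.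
(So `Δ¹ = H + gauge-fixing¹` and `Δ² = H + gauge-fixing²` differ, after the shear, only in the gauge-fixing term.) [folklore] -/
theorem shear_conj_of_mul_eq_zero [DecidableEq p] (H N : Matrix p p ℝ) (hH : Hᵀ = H) (hHN : H * N = 0) :
    (1 + N)ᵀ * H * (1 + N) = H := by
  have hNH : Nᵀ * H = 0 := by
    have := congrArg Matrix.transpose hHN
    rwa [Matrix.transpose_mul, hH, Matrix.transpose_zero] at this
  rw [Matrix.transpose_add, Matrix.transpose_one, Matrix.add_mul, Matrix.one_mul, hNH, add_zero, Matrix.mul_add, Matrix.mul_one, hHN,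
    add_zero]

omit [Fintype q] in
/-- **STEP (0), KERNEL TRANSPORT**: if the two linearised constraints are shear-related, `C₁ * S = C₂`, then `S` maps `ker C₂` into `ker C₁`
(the fluctuation spaces of the two schemes are identified by the shear). [folklore] -/
theorem kernel_transport (C₁ C₂ : Matrix q p ℝ) (S : Matrix p p ℝ) (hC : C₁ * S = C₂) (v : p → ℝ) (hv : C₂.mulVec v = 0) :
    C₁.mulVec (S.mulVec v) = 0 := by
  rw [Matrix.mulVec_mulVec, hC, hv]

/-- **STEP (2a), THE `∂²K` TRACE SPLITS INTO ONE HARD TERM + COARSE-LEG TERMS**: for a block 'inverse' `X = [[𝒢, ℋ],[ℋ′, 𝒮′]]` and a block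
'second variation' `[[A, Bᵀ],[B, 0]]` (`A = ∂²Δ`, `B = ∂²C̃`): `tr(X·∂²K) = tr(𝒢A) + (tr(ℋB) + tr(ℋ′Bᵀ))` — only `tr(𝒢A)` is free of the coarse
legs `ℋ, ℋ′`. [folklore] -/
theorem kkt_trace_d2_split (𝒢 A : Matrix p p ℝ) (ℋ : Matrix p q ℝ) (ℋ' : Matrix q p ℝ) (𝒮' : Matrix q q ℝ) (B : Matrix q p ℝ) :
    Matrix.trace (Matrix.fromBlocks 𝒢 ℋ ℋ' 𝒮' * Matrix.fromBlocks A Bᵀ B 0)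
      = Matrix.trace (𝒢 * A) + (Matrix.trace (ℋ * B) + Matrix.trace (ℋ' * Bᵀ)) := by
  rw [Matrix.fromBlocks_multiply, trace_fromBlocks_eq]
  simp only [Matrix.mul_zero, add_zero, Matrix.trace_add]
  ring

/-- **STEP (2b), THE `(K₀⁻¹∂K)²` TRACE SPLITS INTO ONE HARD TERM + COARSE-LEG TERMS**: with `X = [[𝒢, ℋ],[ℋ′, 𝒮′]]`, `∂K = [[A, Bᵀ],[B, 0]]`
(`A = ∂Δ`, `B = ∂C̃`): `tr((X·∂K)²) = tr((𝒢A)²) + R`, where EVERY term of `R` carries a coarse leg (`ℋ`, `ℋ′` or `𝒮′`) AND a constraint variation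
(`B` or `Bᵀ`).  The hard term `tr((𝒢A)²)` (two fine propagators, two Hessian vertices) is the only `log`-capable one; its scheme difference is a Ward
contact (step (3), informal). [folklore] -/
theorem kkt_trace_sq_split (𝒢 A : Matrix p p ℝ) (ℋ : Matrix p q ℝ) (ℋ' : Matrix q p ℝ) (𝒮' : Matrix q q ℝ) (B : Matrix q p ℝ) :
    Matrix.trace ((Matrix.fromBlocks 𝒢 ℋ ℋ' 𝒮' * Matrix.fromBlocks A Bᵀ B 0) * (Matrix.fromBlocks 𝒢 ℋ ℋ' 𝒮' * Matrix.fromBlocks A Bᵀ B 0))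
      = Matrix.trace (𝒢 * A * (𝒢 * A))
        + (Matrix.trace (𝒢 * A * (ℋ * B)) + Matrix.trace (ℋ * B * (𝒢 * A)) + Matrix.trace (ℋ * B * (ℋ * B))
          + Matrix.trace (𝒢 * Bᵀ * (ℋ' * A)) + Matrix.trace (𝒢 * Bᵀ * (𝒮' * B))
          + Matrix.trace (ℋ' * A * (𝒢 * Bᵀ)) + Matrix.trace (𝒮' * B * (𝒢 * Bᵀ)) + Matrix.trace (ℋ' * Bᵀ * (ℋ' * Bᵀ))) := by
  rw [Matrix.fromBlocks_multiply]
  simp only [Matrix.mul_zero, add_zero]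
  rw [Matrix.fromBlocks_multiply, trace_fromBlocks_eq]
  simp only [Matrix.add_mul, Matrix.mul_add, Matrix.trace_add]
  ring

end CoarseLeg

end Summit.QuantumFields.YangMills.Cruxes.EndpointGivenBR13SepCoPH.NestingInheritance
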